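import Mathlib
import Summits.Ventures.PercRepro2.TB14MarkEdge

/-!
# The edge from a mark to the opposite root never hurts (typed BHK 1.4): Theorem Q
(blind cell PercRepro2, mine-c g18, 2026-08-25; `proofs/MINEC-TB14BLOCK.md` §12.9)

For a free edge `e = b a₂` (the mark `b` to the OTHER root), splitting the two-copy sum of the
folded kernel on `e` (`pairCount_foldK_markEdge`, which holds for every edge) gives the defect
`foldK (y₂[e ↦ 1]) w₂ + foldK y₂ (w₂[e ↦ 1]) − foldK y₂ w₂`.  The first summand vanishes
pointwise (`b ∈ C_y(a₁)` together with the open edge `b a₂` connects the roots in the first copy),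
and the other two combine into  `N + X`  with
`N = 1_Q(y) 1_Q(w) 1[b ∈ C_y(a₁)] 1[b ∉ C_w(a₁)] 1[o ∉ C_w(a₂)] 1[o ∈ C_w(b)] ≥ 0`
(the blue component of `b`, now hung on `a₂`, captures `o`) and
`X = 1_Q(y) 1_Q(w) 1[b ∈ C_y(a₁)] 1[b ∈ C_w(a₁)] (1[o ∈ C_y(a₂)] − 1[o ∈ C_w(a₂)])`, which is
antisymmetric under the exchange of the two copies and so has two-copy count `0`
(`pairCount_antisymm_eq_zero`, via `pairCount_swap`).  Hence (`pairCount_foldK_le_oppRootEdge`)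

  `D(G − b a₂) ≤ D(G)`   at every profile in which `b a₂` is free,

and by the relabelling symmetry `(a₁, a₂, b, o) ↦ (a₂, a₁, o, b)` the same for the edge `o a₁`
(`pairCount_foldK_le_oppRootEdge'`): the core of row 2′TB has `b ≁ a₂` and `o ≁ a₁`.  Exact check
`data/mine-c/g18/scripts/oppedge.c` (the closed formula for the defect, n ≤ 7 m ≤ 10, 0 failures).
Own work; standard axioms.
-/

namespace Summit.Ventures.PercRepro2

namespace TB14Cut

open CovForm A3InactiveTyped

section OppRootEdge

variable {V : Type} {E : Type} [Fintype E] [DecidableEq E] {R : Type*} [Field R]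
variable {ends : E → Sym2 V} {e : E} {a₁ a₂ b o : V}

/-- The two-copy count of the negative of a kernel is the negative of the count. -/
lemma pairCount_neg (F : Finset E) (z : Config E) (Φ : Config E → Config E → R) :
    pairCount F z (fun y w => - Φ y w) = - pairCount F z Φ := by
  unfold pairCount
  rw [← Finset.sum_neg_distrib]
  refine Finset.sum_congr rfl fun y _ => ?_
  split_ifs <;> simp

/-- The two-copy count of an antisymmetric kernel vanishes (ordered field). -/
lemma pairCount_antisymm_eq_zero [LinearOrder R] [IsStrictOrderedRing R] (F : Finset E)
    (z : Config E) (Φ : Config E → Config E → R) (hswap : ∀ y w, Φ w y = - Φ y w) :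
    pairCount F z Φ = 0 := by
  have h := pairCount_swap F z Φ
  have h2 : pairCount F z (fun y w => Φ w y) = pairCount F z (fun y w => - Φ y w) := by
    congr 1
    funext y w
    exact hswap y w
  rw [h2, pairCount_neg] at h
  linarith

/-- The nonnegative part of the defect of the edge `b a₂`: `b` red-only at `a₁`, `o` in the blue
component of `b` but not in the blue cluster of `a₂`. -/
noncomputable def oppRootN (ends : E → Sym2 V) (a₁ a₂ b o : V) : Config E → Config E → R :=
  fun y w => iQ ends a₁ a₂ y * iQ ends a₁ a₂ w * iL ends a₁ b y * (1 - iL ends a₁ b w) *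
    (1 - iH ends a₂ o w) * iL ends b o w

/-- The antisymmetric part of the defect of the edge `b a₂`. -/
noncomputable def oppRootX (ends : E → Sym2 V) (a₁ a₂ b o : V) : Config E → Config E → R :=
  fun y w => iQ ends a₁ a₂ y * iQ ends a₁ a₂ w * iL ends a₁ b y * iL ends a₁ b w *
    (iH ends a₂ o y - iH ends a₂ o w)

omit [Fintype E] [DecidableEq E] in
/-- The antisymmetric part changes sign under the exchange of the two copies. -/
lemma oppRootX_swap (y w : Config E) :
    (oppRootX ends a₁ a₂ b o w y : R) = - oppRootX ends a₁ a₂ b o y w := by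
  simp only [oppRootX]; ring

omit [Fintype E] [DecidableEq E] in
/-- The nonnegative part is pointwise nonnegative (a product of indicators). -/
lemma oppRootN_nonneg [LinearOrder R] [IsStrictOrderedRing R] (y w : Config E) :
    (0 : R) ≤ oppRootN ends a₁ a₂ b o y w := by
  classical
  simp only [oppRootN, iQ_eq_ite', iL_eq_ite', iH_eq_ite']
  split_ifs <;> norm_num

omit [Fintype E] in
/-- The Boolean core of Theorem Q. -/
lemma oppRoot_key (A1 A2 A3 A6 A8 A9 A11 C : Prop) [Decidable A1] [Decidable A2] [Decidable A3]
    [Decidable A6] [Decidable A8] [Decidable A9] [Decidable A11] [Decidable C] :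
    (if A1 ∨ A3 then (0 : R) else 1) * (if A2 then 0 else 1) * (if A3 ∨ A1 then 1 else 0) *
          ((if A8 then 1 else 0) - (if C then 1 else 0)) +
        (if A1 then 0 else 1) * (if A2 ∨ A9 then 0 else 1) * (if A3 then 1 else 0) *
          ((if A8 ∨ A11 then 1 else 0) - (if A6 then 1 else 0)) -
        (if A1 then 0 else 1) * (if A2 then 0 else 1) * (if A3 then 1 else 0) *
          ((if A8 then 1 else 0) - (if A6 then 1 else 0)) =
      (if A1 then 0 else 1) * (if A2 then 0 else 1) * (if A3 then 1 else 0) *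
          (1 - (if A9 then 1 else 0)) * (1 - (if A8 then 1 else 0)) * (if A11 then 1 else 0) +
        (if A1 then 0 else 1) * (if A2 then 0 else 1) * (if A3 then 1 else 0) *
          (if A9 then 1 else 0) * ((if A6 then 1 else 0) - (if A8 then 1 else 0)) := by
  by_cases hA1 : A1
  · simp [hA1]
  by_cases hA2 : A2
  · simp [hA2]
  by_cases hA3 : A3
  · by_cases hA9 : A9
    · simp [hA1, hA2, hA3, hA9]
    · by_cases hA8 : A8
      · simp [hA1, hA2, hA3, hA9, hA8]
      · simp [hA1, hA2, hA3, hA9, hA8]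
  · simp [hA1, hA3]

omit [Fintype E] in
/-- The defect of the edge `b a₂` at a pair with the edge closed in both copies is `N + X`. -/
lemma markEdgeDefect_oppRoot_eq (he : ends e = s(b, a₂)) (y₂ w₂ : Config E) (hy : y₂ e = false)
    (hw : w₂ e = false) :
    (markEdgeDefect ends e a₁ a₂ b o y₂ w₂ : R) =
      oppRootN ends a₁ a₂ b o y₂ w₂ + oppRootX ends a₁ a₂ b o y₂ w₂ := by
  classical
  have hy' := conn_update_true_iff (ends := ends) he hy
  have hw' := conn_update_true_iff (ends := ends) he hw
  have hQy' : Conn ends (Function.update y₂ e true) a₁ a₂ ↔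
      Conn ends y₂ a₁ a₂ ∨ Conn ends y₂ a₁ b := by
    rw [hy' a₁ a₂]
    constructor
    · rintro (h | ⟨h1, _⟩ | ⟨h1, _⟩)
      · exact Or.inl h
      · exact Or.inr h1
      · exact Or.inl h1
    · rintro (h | h)
      · exact Or.inl h
      · exact Or.inr (Or.inl ⟨h, conn_refl _ _ _⟩)
  have hLy' : Conn ends (Function.update y₂ e true) a₁ b ↔
      Conn ends y₂ a₁ b ∨ Conn ends y₂ a₁ a₂ := by
    rw [hy' a₁ b]
    constructor
    · rintro (h | ⟨h1, _⟩ | ⟨h1, _⟩)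
      · exact Or.inl h
      · exact Or.inl h1
      · exact Or.inr h1
    · rintro (h | h)
      · exact Or.inl h
      · exact Or.inr (Or.inr ⟨h, conn_refl _ _ _⟩)
  have hQw' : Conn ends (Function.update w₂ e true) a₁ a₂ ↔
      Conn ends w₂ a₁ a₂ ∨ Conn ends w₂ a₁ b := by
    rw [hw' a₁ a₂]
    constructor
    · rintro (h | ⟨h1, _⟩ | ⟨h1, _⟩)
      · exact Or.inl h
      · exact Or.inr h1
      · exact Or.inl h1
    · rintro (h | h)
      · exact Or.inl h
      · exact Or.inr (Or.inl ⟨h, conn_refl _ _ _⟩)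
  have hHw' : Conn ends (Function.update w₂ e true) a₂ o ↔
      Conn ends w₂ a₂ o ∨ Conn ends w₂ b o := by
    rw [hw' a₂ o]
    constructor
    · rintro (h | ⟨_, h2⟩ | ⟨_, h2⟩)
      · exact Or.inl h
      · exact Or.inl h2
      · exact Or.inr h2
    · rintro (h | h)
      · exact Or.inl h
      · exact Or.inr (Or.inr ⟨conn_refl _ _ _, h⟩)
  simp only [markEdgeDefect, foldK, oppRootN, oppRootX, iQ_eq_ite', iL_eq_ite', iH_eq_ite', hQy',
    hLy', hQw', hHw']
  exact oppRoot_key (Conn ends y₂ a₁ a₂) (Conn ends w₂ a₁ a₂) (Conn ends y₂ a₁ b)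
    (Conn ends y₂ a₂ o) (Conn ends w₂ a₂ o) (Conn ends w₂ a₁ b) (Conn ends w₂ b o)
    (Conn ends (Function.update y₂ e true) a₂ o)

/-- **THEOREM Q — the edge from the mark `b` to the opposite root `a₂` never hurts**:
`D(G − b a₂) ≤ D(G)` at every profile in which `b a₂` is free. -/
theorem pairCount_foldK_le_oppRootEdge [LinearOrder R] [IsStrictOrderedRing R]
    (he : ends e = s(b, a₂)) (F : Finset E) (z : Config E) (heF : e ∈ F) :
    pairCount (F.erase e) (Function.update z e false)
        (foldK ends a₁ a₂ b o : Config E → Config E → R) ≤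
      pairCount F z (foldK ends a₁ a₂ b o) := by
  classical
  rw [pairCount_foldK_markEdge F z heF]
  refine le_add_of_nonneg_right ?_
  have hsplit : pairCount (F.erase e) (Function.update z e false)
      (markEdgeDefect ends e a₁ a₂ b o : Config E → Config E → R) =
      pairCount (F.erase e) (Function.update z e false) (oppRootN ends a₁ a₂ b o) +
        pairCount (F.erase e) (Function.update z e false) (oppRootX ends a₁ a₂ b o) := by
    unfold pairCount
    rw [← Finset.sum_add_distrib]
    refine Finset.sum_congr rfl fun y₂ _ => ?_
    by_cases hadm : ∀ f, f ∉ F.erase e → y₂ f = Function.update z e false f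
    · rw [if_pos hadm, if_pos hadm, if_pos hadm]
      have hy₂ : y₂ e = false := by
        have := hadm e (Finset.notMem_erase e F)
        rwa [Function.update_self] at this
      have hw₂ : A3InactiveTyped.flipOn (F.erase e) y₂ e = false := by
        rw [A3InactiveTyped.flipOn_of_notMem (Finset.notMem_erase e F)]; exact hy₂
      exact markEdgeDefect_oppRoot_eq he y₂ _ hy₂ hw₂
    · rw [if_neg hadm, if_neg hadm, if_neg hadm, add_zero]
  rw [hsplit, pairCount_antisymm_eq_zero _ _ _ (oppRootX_swap (ends := ends) (a₁ := a₁) (a₂ := a₂)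
    (b := b) (o := o)), add_zero]
  exact pairCount_nonneg _ _ _ (fun y w => oppRootN_nonneg y w)

/-- **THEOREM Q′ (the mirror)** — the edge from the mark `o` to the opposite root `a₁` never hurts:
`D(G − o a₁) ≤ D(G)`, via the relabelling `(a₁, a₂, b, o) ↦ (a₂, a₁, o, b)` of the slack. -/
theorem pairCount_foldK_le_oppRootEdge' [LinearOrder R] [IsStrictOrderedRing R]
    (he : ends e = s(o, a₁)) (F : Finset E) (z : Config E) (heF : e ∈ F) :
    pairCount (F.erase e) (Function.update z e false)
        (foldK ends a₁ a₂ b o : Config E → Config E → R) ≤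
      pairCount F z (foldK ends a₁ a₂ b o) := by
  classical
  have h1 := slack_eq_pairCount_foldK (R := R) ends a₁ a₂ b o F z
  have h2 := slack_eq_pairCount_foldK (R := R) ends a₁ a₂ b o (F.erase e)
    (Function.update z e false)
  have h3 := slack_eq_pairCount_foldK (R := R) ends a₂ a₁ o b F z
  have h4 := slack_eq_pairCount_foldK (R := R) ends a₂ a₁ o b (F.erase e)
    (Function.update z e false)
  have h5 := tb14_slack_relabel (R := R) ends a₁ a₂ b o F z
  have h6 := tb14_slack_relabel (R := R) ends a₁ a₂ b o (F.erase e) (Function.update z e false)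
  have hQ := pairCount_foldK_le_oppRootEdge (R := R) (ends := ends) (a₁ := a₂) (a₂ := a₁) (b := o)
    (o := b) he F z heF
  linarith

end OppRootEdge

end TB14Cut

end Summit.Ventures.PercRepro2
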